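import Literature.AlgebraicGeometry.Motives.MiddleConvolutionLocalData
import HarnessLib

/-!
# The additive middle convolution `mc_μ` and the addition `ad_α` (Dettweiler–Reiter, Haraoka)

Topic `Literature/AlgebraicGeometry/Motives`; the ADDITIVE companion of
`Literature.AlgebraicGeometry.Motives.middleConvolution` (`MiddleConvolution.lean`, the multiplicative
`MC_λ` of Katz–Dettweiler–Reiter on modules over the free group, i.e. on monodromy tuples
`(M₁, …, M_p) ∈ GL(V)^p` of local systems on `ℂ ∖ {a₁, …, a_p}`).  The additive version acts on
tuples `A = (A₁, …, A_p) ∈ End(V)^p` — the residue matrices of a Fuchsian system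
`dY/dx = (Σ_j A_j/(x - a_j)) Y` — and is Katz's middle convolution transported through the
Riemann–Hilbert correspondence (`mc_μ` on residues ↔ `MC_{e^{2πiμ}}` on monodromy,
[DettweilerReiter2007, Thm. 4.8]; [Haraoka2020, §7.5.1]).  Sources followed verbatim:
[Haraoka2020, §7.5, (7.29)–(7.32), conditions (M1), (M2), Lemma 7.16, Thm. 7.12] (over `ℂ`) =
[DettweilerReiter2000, Appendix A, Def. A.2, Lemma A.4, Cor. A.5, Def. A.6] =
[DettweilerReiter2007, Def. 3.1] (over any field `K`, `μ ∈ K`; we allow a commutative ring).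

* `AdditiveMiddleConvolution.addition A α = ad_α(A) = (A_j + α_j)_j` ([Haraoka2020, §7.5, before
  (7.30)]; [DettweilerReiter2000, Def. A.6 (b)] "addition `M_Λ`").
* `AdditiveMiddleConvolution.convolutionEnd A μ j = G_j ∈ End(V^p)` ([Haraoka2020, (7.30)]:
  `G_j = Σ_k E_{jk} ⊗ (A_k + δ_{jk} μ)`, zero outside the `j`-th block row, which is
  `(A₁, …, A_j + μ, …, A_p)`), i.e. `G_j v = e_j ⊗ (Σ_k A_k v_k + μ v_j)` (`convolutionEnd_apply`).
* `AdditiveMiddleConvolution.piKer A = 𝒦 = ⊕_j Ker A_j` and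
  `AdditiveMiddleConvolution.invariants A μ = ℒ = Ker(G₁ + ⋯ + G_p)` ([Haraoka2020, (7.31)]),
  `kerSum A μ = 𝒦 + ℒ`, all `G_j`-invariant (`kerSum_le_comap`), and
  `AdditiveMiddleConvolution.Space A μ = V^p ⧸ (𝒦 + ℒ) = mc_μ(V)`.
* `additiveMiddleConvolution A μ = mc_μ(A) = (B₁, …, B_p)`, the tuple of endomorphisms of
  `V^p ⧸ (𝒦 + ℒ)` induced by `(G₁, …, G_p)` ([Haraoka2020, (7.32)]; [DettweilerReiter2007, Def. 3.1]).
* Conditions `CondM1 A` = (M1): `⋂_{j ≠ i} Ker A_j ∩ Ker(A_i + c) = 0` and `CondM2 A` = (M2):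
  `Σ_{j ≠ i} Im A_j + Im(A_i + c) = V` (all `i`, all `c`) [Haraoka2020, §7.5, before Thm. 7.12].
* `AdditiveMiddleConvolution.residueAtInfinity A = A₀ = -Σ_j A_j` ([Haraoka2020, (7.16)]) and the
  additive **index of rigidity** `rigidityIndex A = (1 - p) n² + Σ_{j=0}^{p} dim Z(A_j)`
  ([Haraoka2020, Def. 7.6]; `Z` = centraliser, tree `RigidTuple.centralizerDim`).

## Results (proved)
* [Haraoka2020, Lemma 7.16]: (i) `ℒ = ⋂_i Ker G_i` (`mem_invariants_iff`, `invariants_eq_iInf`);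
  (ii) for a unit `μ`, `ℒ = {(u, …, u) | (μ + Σ A_i) u = 0}` (`mem_invariants_iff_of_isUnit`), and for
  `μ = 0`, `ℒ = {v | Σ A_i v_i = 0} ⊇ 𝒦` (`mem_invariants_zero_iff`, `piKer_le_invariants_zero`);
  (iii) `𝒦 ∩ ℒ = 0` for a unit `μ` (`piKer_inf_invariants_eq_bot`).
* [Haraoka2020, Thm. 7.12] (`mc_0(V) ≅ V` under (M2)): `exists_linearEquiv_zero` — the map
  `φ(v) = Σ A_i v_i` induces `V^p ⧸ ℒ ≃ V` with `φ ∘ G_i = A_i ∘ φ`; stated with the hypothesis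
  actually used, `Σ_j Im A_j = V`, which (M2) implies for `p ≥ 1` (`iSup_range_eq_top_of_condM2`,
  `Haraoka2020_thm_7_12`).
* `ad_0 = id`, `ad_α ∘ ad_β = ad_{α+β}`, and `ad_α` preserves the index of rigidity
  ([Haraoka2020, §7.5, before Thm. 7.22]): `addition_zero`, `addition_addition`, `rigidityIndex_addition`;
  rank-one tuples have index `2` (`rigidityIndex_eq_two_of_finrank_eq_one`).

## NOT here (statements in the sources, not yet formalised — request as fact items if needed)
[Haraoka2020, Thm. 7.13] `mc_λ(mc_μ(V)) ≅ mc_{λ+μ}(V)` under (M1), (M2) (the multiplicative analogue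
IS proved in the tree: `DettweilerReiter2007_mul_holds`); [Haraoka2020, Thm. 7.14] `mc_λ` preserves
irreducibility under (M1), (M2) (multiplicative: `MiddleConvolution.isIrreducible_middleConvolution`);
[Haraoka2020, Thm. 7.15, Thm. 7.19, Lemma 7.20] invariance of the index of rigidity under (M2) and the
change of Jordan types (multiplicative local data: `MiddleConvolution.centralizerDim_middleConvolution_local`);
[Haraoka2020, Thm. 7.22] = [DettweilerReiter2000, Thm. A.14] the additive Katz algorithm
(multiplicative: `RigidTuple.reducesToRankOne_of_rigidityIndex_eq_two`, `DettweilerReiter2000_thm_4_9_holds`);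
the Riemann–Hilbert compatibility `mc_μ ↔ MC_{e^{2πiμ}}` [DettweilerReiter2007, Thm. 4.8] (needs
Fuchsian systems and their monodromy, absent from Mathlib).  No Mathlib notion of (additive or
multiplicative) middle convolution exists (`lean search convolution|Pochhammer|Fuchsian`); used:
`Submodule.pi`, `Submodule.mapQ`, `LinearMap.single`, `LinearMap.proj`.

## References
* Y. Haraoka, *Linear Differential Equations in the Complex Domain. From Classical Theory to
  Forefront*, LNM 2271, Springer 2020, §7.3 (7.16), §7.4 Def. 7.6, §7.5 (pp. 159–196): (7.29)–(7.32),
  (M1), (M2),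
  Thm. 7.12–7.15, Lemma 7.16–7.18, Thm. 7.19, 7.22, §7.5.1 (pp. 194–196) [Haraoka2020].
* M. Dettweiler, S. Reiter, *An algorithm of Katz and its application to the inverse Galois
  problem*, J. Symbolic Comput. 30 (2000) 761–798, Appendix A (Def. A.2, Lemma A.4, Cor. A.5,
  Def. A.6, Thm. A.14) [DettweilerReiter2000].
* M. Dettweiler, S. Reiter, *Middle convolution of Fuchsian systems and the construction of rigid
  differential systems*, J. Algebra 318 (2007) 1–24, Def. 3.1, Thm. 4.8 [DettweilerReiter2007].
-/

noncomputable section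

namespace Literature.AlgebraicGeometry.Motives

open Module

namespace AdditiveMiddleConvolution

section Defs

variable {K : Type*} [CommRing K] {V : Type*} [AddCommGroup V] [Module K V]
variable {ι : Type*} [Fintype ι] [DecidableEq ι]

/-! ### Addition `ad_α` -/

/-- The **addition** `ad_α(A) = (A₁ + α₁, …, A_p + α_p)` of a tuple of endomorphisms by a vector of
scalars `α` ([Haraoka2020, §7.5]; = [DettweilerReiter2000, Def. A.6 (b)] "addition `M_Λ(T)`"); on
Fuchsian systems it is the gauge transformation `Y ↦ ∏ (x - a_j)^{α_j} Y` ([Haraoka2020, (7.33)]).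
[cite: Haraoka2020, §7.5 (addition ad_α, before (7.30))] -/
def addition (A : ι → Module.End K V) (α : ι → K) : ι → Module.End K V :=
  fun j => A j + α j • (1 : Module.End K V)

omit [Fintype ι] [DecidableEq ι] in
/-- `ad_α(A)_j x = A_j x + α_j x`. [cite: Haraoka2020, §7.5 (addition ad_α)] -/
@[simp]
theorem addition_apply (A : ι → Module.End K V) (α : ι → K) (j : ι) (x : V) :
    addition A α j x = A j x + α j • x :=
  rfl

omit [Fintype ι] [DecidableEq ι] in
/-- `ad_0 = id`. [cite: Haraoka2020, §7.5 (properties of ad_α, before Thm. 7.22)] -/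
@[simp]
theorem addition_zero (A : ι → Module.End K V) : addition A 0 = A := by
  funext j
  simp [addition]

omit [Fintype ι] [DecidableEq ι] in
/-- `ad_α ∘ ad_β = ad_{α+β}` (as printed: applying `ad_β` and then `ad_α` is `ad_{α+β}`).
[cite: Haraoka2020, §7.5 (properties of ad_α, before Thm. 7.22)] -/
theorem addition_addition (A : ι → Module.End K V) (α β : ι → K) :
    addition (addition A β) α = addition A (α + β) := by
  funext j
  simp only [addition, Pi.add_apply, add_smul]
  abel

/-! ### The operators `G_j` of (7.30) and the spaces `𝒦`, `ℒ` of (7.31) -/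

/-- The common block row `(A₁ A₂ ⋯ A_p)` of the matrices `G_j`: `v ↦ Σ_k A_k v_k`
([Haraoka2020, (7.30) and the matrix `G` after (7.34)]). [cite: Haraoka2020, §7.5 (7.30)] -/
def rowMap (A : ι → Module.End K V) : (ι → V) →ₗ[K] V :=
  ∑ k, A k ∘ₗ LinearMap.proj k

omit [DecidableEq ι] in
/-- `rowMap A v = Σ_k A_k v_k`. [cite: Haraoka2020, §7.5 (7.30)] -/
theorem rowMap_apply (A : ι → Module.End K V) (v : ι → V) : rowMap A v = ∑ k, A k (v k) := by
  simp [rowMap, LinearMap.sum_apply]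

/-- `rowMap` of a vector supported in slot `k` is `A_k x`. [folklore] -/
theorem rowMap_single (A : ι → Module.End K V) (k : ι) (x : V) :
    rowMap A (Pi.single k x) = A k x := by
  rw [rowMap_apply, Finset.sum_eq_single k]
  · rw [Pi.single_eq_same]
  · intro j _ hj
    rw [Pi.single_eq_of_ne hj, map_zero]
  · intro hk
    exact absurd (Finset.mem_univ k) hk

omit [DecidableEq ι] in
/-- `rowMap` of a constant vector `(u, …, u)` is `(Σ_k A_k) u`. [folklore] -/
theorem rowMap_const (A : ι → Module.End K V) (u : V) :
    rowMap A (Function.const ι u) = (∑ k, A k) u := by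
  rw [rowMap_apply, LinearMap.sum_apply]
  rfl

/-- **The operator `G_j = Σ_k E_{jk} ⊗ (A_k + δ_{jk} μ)`** of [Haraoka2020, (7.30)] (= `G_i` of
[DettweilerReiter2000, Def. A.2], `b_k` of [DettweilerReiter2007, Def. 3.1]): zero outside the
`j`-th block row, which is `(A₁, …, A_{j-1}, A_j + μ, A_{j+1}, …, A_p)`.
[cite: Haraoka2020, §7.5 (7.30)] -/
def convolutionEnd (A : ι → Module.End K V) (μ : K) (j : ι) : Module.End K (ι → V) :=
  LinearMap.single K (fun _ : ι => V) j ∘ₗ (rowMap A + μ • LinearMap.proj j)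

/-- `G_j v = e_j ⊗ (Σ_k A_k v_k + μ v_j)`. [cite: Haraoka2020, §7.5 (7.30)] -/
theorem convolutionEnd_apply (A : ι → Module.End K V) (μ : K) (j : ι) (v : ι → V) :
    convolutionEnd A μ j v = Pi.single j (rowMap A v + μ • v j) :=
  rfl

/-- The `j`-th coordinate of `G_j v`. [cite: Haraoka2020, §7.5 (7.30)] -/
theorem convolutionEnd_apply_same (A : ι → Module.End K V) (μ : K) (j : ι) (v : ι → V) :
    convolutionEnd A μ j v j = rowMap A v + μ • v j := by
  rw [convolutionEnd_apply, Pi.single_eq_same]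

/-- The coordinates `i ≠ j` of `G_j v` vanish. [cite: Haraoka2020, §7.5 (7.30)] -/
theorem convolutionEnd_apply_of_ne (A : ι → Module.End K V) (μ : K) {i j : ι} (h : i ≠ j)
    (v : ι → V) : convolutionEnd A μ j v i = 0 := by
  rw [convolutionEnd_apply, Pi.single_eq_of_ne h]

/-- `(Σ_j G_j) v = (Σ_k A_k v_k + μ v_i)_i` — the matrix `G + μ` all of whose block rows are
`(A₁, …, A_i + μ, …, A_p)`. [cite: Haraoka2020, §7.5 (7.31)] -/
theorem sum_convolutionEnd_apply (A : ι → Module.End K V) (μ : K) (v : ι → V) (i : ι) :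
    (∑ j, convolutionEnd A μ j) v i = rowMap A v + μ • v i := by
  rw [LinearMap.sum_apply, Finset.sum_apply, Finset.sum_eq_single i]
  · exact convolutionEnd_apply_same A μ i v
  · intro j _ hj
    exact convolutionEnd_apply_of_ne A μ hj.symm v
  · intro hi
    exact absurd (Finset.mem_univ i) hi

/-- The subspace `𝒦 = {(v₁, …, v_p) | v_j ∈ Ker A_j}` of `V^p` ([Haraoka2020, (7.31)];
`K = (ker A₁, …, ker A_r)ᵗʳ` of [DettweilerReiter2000, Lemma A.4 (a)]). [cite: Haraoka2020, §7.5 (7.31)] -/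
def piKer (A : ι → Module.End K V) : Submodule K (ι → V) :=
  Submodule.pi Set.univ fun j => LinearMap.ker (A j)

omit [Fintype ι] [DecidableEq ι] in
/-- Membership in `𝒦`. [cite: Haraoka2020, §7.5 (7.31)] -/
theorem mem_piKer_iff (A : ι → Module.End K V) (v : ι → V) : v ∈ piKer A ↔ ∀ j, A j (v j) = 0 := by
  simp [piKer, Submodule.mem_pi, LinearMap.mem_ker]

/-- The subspace `ℒ = Ker(G₁ + G₂ + ⋯ + G_p)` of `V^p` ([Haraoka2020, (7.31)]; it depends on `μ`,
"`ℒ_V(λ)`"). [cite: Haraoka2020, §7.5 (7.31)] -/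
def invariants (A : ι → Module.End K V) (μ : K) : Submodule K (ι → V) :=
  LinearMap.ker (∑ j, convolutionEnd A μ j)

/-- **[Haraoka2020, Lemma 7.16 (i)]**: `ℒ = ⋂_i Ker G_i`, i.e. `v ∈ ℒ ⟺ Σ_k A_k v_k + μ v_i = 0`
for every `i` (= [DettweilerReiter2000, Lemma A.4 (b)], where `ℒ` is *defined* as `⋂ ker G_i`).
[cite: Haraoka2020, Lemma 7.16 (i)] -/
theorem mem_invariants_iff (A : ι → Module.End K V) (μ : K) (v : ι → V) :
    v ∈ invariants A μ ↔ ∀ i, rowMap A v + μ • v i = 0 := by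
  rw [invariants, LinearMap.mem_ker, funext_iff]
  simp only [sum_convolutionEnd_apply, Pi.zero_apply]

/-- `v ∈ Ker G_i ⟺ Σ_k A_k v_k + μ v_i = 0`. [cite: Haraoka2020, Lemma 7.16 (i)] -/
theorem mem_ker_convolutionEnd_iff (A : ι → Module.End K V) (μ : K) (i : ι) (v : ι → V) :
    v ∈ LinearMap.ker (convolutionEnd A μ i) ↔ rowMap A v + μ • v i = 0 := by
  rw [LinearMap.mem_ker, convolutionEnd_apply]
  exact Pi.single_eq_zero_iff

/-- [Haraoka2020, Lemma 7.16 (i)] as an equality of subspaces: `ℒ = ⋂_i Ker G_i`.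
[cite: Haraoka2020, Lemma 7.16 (i)] -/
theorem invariants_eq_iInf (A : ι → Module.End K V) (μ : K) :
    invariants A μ = ⨅ i, LinearMap.ker (convolutionEnd A μ i) := by
  ext v
  rw [mem_invariants_iff, Submodule.mem_iInf]
  simp only [mem_ker_convolutionEnd_iff]

/-- **[Haraoka2020, Lemma 7.16 (ii)], `μ ≠ 0`** (here: `μ` a unit): `ℒ = {(u, …, u) | (μ + Σ A_i) u = 0}`
(= [DettweilerReiter2000, Lemma A.4]: "`L = {(u, …, u)ᵗʳ | u ∈ ker(A_∞ + λ)}`", `A_∞ = Σ A_i`).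
[cite: Haraoka2020, Lemma 7.16 (ii)] -/
theorem mem_invariants_iff_of_isUnit (A : ι → Module.End K V) {μ : K} (hμ : IsUnit μ) (v : ι → V) :
    v ∈ invariants A μ ↔ ∃ u : V, v = Function.const ι u ∧ (∑ i, A i) u + μ • u = 0 := by
  rw [mem_invariants_iff]
  constructor
  · intro h
    cases isEmpty_or_nonempty ι with
    | inl hι =>
      refine ⟨0, Subsingleton.elim _ _, ?_⟩
      rw [map_zero, smul_zero, add_zero]
    | inr hι =>
      obtain ⟨i₀⟩ := hι
      have hconst : ∀ i, v i = v i₀ := by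
        intro i
        have hi := h i
        rw [← h i₀, add_right_inj] at hi
        exact hμ.smul_left_cancel.1 hi
      refine ⟨v i₀, funext hconst, ?_⟩
      have hv : v = Function.const ι (v i₀) := funext hconst
      have := h i₀
      rwa [hv, rowMap_const] at this
  · rintro ⟨u, rfl, hu⟩ i
    rwa [rowMap_const]

/-- **[Haraoka2020, Lemma 7.16 (ii)], `μ = 0`**: `ℒ = {(v₁, …, v_p) | Σ A_i v_i = 0}`
(= [DettweilerReiter2000, Lemma A.4], case `λ = 0`). [cite: Haraoka2020, Lemma 7.16 (ii)] -/
theorem mem_invariants_zero_iff (A : ι → Module.End K V) (v : ι → V) :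
    v ∈ invariants A 0 ↔ rowMap A v = 0 := by
  rw [mem_invariants_iff]
  simp only [zero_smul, add_zero]
  cases isEmpty_or_nonempty ι with
  | inl hι =>
    refine ⟨fun _ => ?_, fun h _ => h⟩
    rw [rowMap_apply]
    exact Finset.sum_of_isEmpty _
  | inr hι => exact ⟨fun h => h (Classical.arbitrary ι), fun h _ => h⟩

/-- [Haraoka2020, Lemma 7.16 (ii)]: for `μ = 0`, "in particular `𝒦 ⊂ ℒ`". [cite: Haraoka2020, Lemma 7.16 (ii)] -/
theorem piKer_le_invariants_zero (A : ι → Module.End K V) : piKer A ≤ invariants A 0 := by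
  intro v hv
  rw [mem_invariants_zero_iff, rowMap_apply]
  exact Finset.sum_eq_zero fun j _ => (mem_piKer_iff A v).1 hv j

/-- **[Haraoka2020, Lemma 7.16 (iii)]** (= [DettweilerReiter2000, Cor. A.5]): for `μ ≠ 0` (a unit),
`𝒦 ∩ ℒ = {0}`, so `𝒦 + ℒ = 𝒦 ⊕ ℒ`. [cite: Haraoka2020, Lemma 7.16 (iii)] -/
theorem piKer_inf_invariants_eq_bot (A : ι → Module.End K V) {μ : K} (hμ : IsUnit μ) :
    piKer A ⊓ invariants A μ = ⊥ := by
  rw [eq_bot_iff]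
  rintro v ⟨hK, hL⟩
  obtain ⟨u, rfl, hu⟩ := (mem_invariants_iff_of_isUnit A hμ _).1 hL
  have hAu : (∑ i, A i) u = 0 := by
    rw [LinearMap.sum_apply]
    exact Finset.sum_eq_zero fun j _ => (mem_piKer_iff A _).1 hK j
  rw [hAu, zero_add] at hu
  have hu0 : u = 0 := hμ.smul_left_cancel.1 (by rw [hu, smul_zero])
  rw [hu0, Submodule.mem_bot]
  rfl

/-- The subspace `𝒦 + ℒ` of `V^p` by which `mc_μ(V) = V^p ⧸ (𝒦 + ℒ)` is the quotient.
[cite: Haraoka2020, §7.5 (7.31)–(7.32)] -/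
def kerSum (A : ι → Module.End K V) (μ : K) : Submodule K (ι → V) :=
  piKer A ⊔ invariants A μ

/-- `𝒦` is `G_j`-invariant: `G_j(𝒦) ⊆ 𝒦` (`G_j v = e_j ⊗ μ v_j` for `v ∈ 𝒦`).
[cite: Haraoka2020, §7.5 (after (7.31))] -/
theorem piKer_le_comap (A : ι → Module.End K V) (μ : K) (j : ι) :
    piKer A ≤ (piKer A).comap (convolutionEnd A μ j) := by
  intro v hv
  rw [Submodule.mem_comap, mem_piKer_iff]
  have hrow : rowMap A v = 0 := by
    rw [rowMap_apply]
    exact Finset.sum_eq_zero fun k _ => (mem_piKer_iff A v).1 hv k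
  intro i
  rcases eq_or_ne i j with rfl | h
  · rw [convolutionEnd_apply_same, hrow, zero_add, map_smul, (mem_piKer_iff A v).1 hv i, smul_zero]
  · rw [convolutionEnd_apply_of_ne A μ h, map_zero]

/-- `ℒ` is killed by every `G_j` (so is `G_j`-invariant). [cite: Haraoka2020, Lemma 7.16 (i)] -/
theorem invariants_le_ker (A : ι → Module.End K V) (μ : K) (j : ι) :
    invariants A μ ≤ LinearMap.ker (convolutionEnd A μ j) := by
  rw [invariants_eq_iInf]
  exact iInf_le _ j

/-- **`𝒦 + ℒ` is `(G₁, …, G_p)`-invariant** ("it is easy to see that both `𝒦` and `ℒ` are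
`(G₁, …, G_p)`-invariant", [Haraoka2020, §7.5]; [DettweilerReiter2000, Lemma A.4]).
[cite: Haraoka2020, §7.5 (before (7.32))] -/
theorem kerSum_le_comap (A : ι → Module.End K V) (μ : K) (j : ι) :
    kerSum A μ ≤ (kerSum A μ).comap (convolutionEnd A μ j) := by
  refine sup_le (fun v hv => ?_) (fun v hv => ?_)
  · exact Submodule.mem_comap.2 (Submodule.mem_sup_left (piKer_le_comap A μ j hv))
  · rw [Submodule.mem_comap, LinearMap.mem_ker.1 (invariants_le_ker A μ j hv)]
    exact zero_mem _

/-- The underlying module `mc_μ(V) = V^p ⧸ (𝒦 + ℒ)` of the additive middle convolution.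
[cite: Haraoka2020, §7.5 (7.32)] -/
abbrev Space (A : ι → Module.End K V) (μ : K) : Type _ := (ι → V) ⧸ kerSum A μ

/-! ### Conditions (M1), (M2) -/

/-- Condition **(M1)** of [Haraoka2020, §7.5 (before Thm. 7.12)] on an `A`-module `V`:
`⋂_{j ≠ i} Ker A_j ∩ Ker(A_i + c) = {0}` for every `i` and every scalar `c` (the additive form of
Dettweiler–Reiter's `(*)`). [cite: Haraoka2020, §7.5 condition (M1)] -/
def CondM1 (A : ι → Module.End K V) : Prop :=
  ∀ (i : ι) (c : K), (⨅ j ∈ {j | j ≠ i}, LinearMap.ker (A j)) ⊓ LinearMap.ker (A i + c • 1) = ⊥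

/-- Condition **(M2)** of [Haraoka2020, §7.5 (before Thm. 7.12)] on an `A`-module `V`:
`Σ_{j ≠ i} Im A_j + Im(A_i + c) = V` for every `i` and every scalar `c` (the additive form of
Dettweiler–Reiter's `(**)`). [cite: Haraoka2020, §7.5 condition (M2)] -/
def CondM2 (A : ι → Module.End K V) : Prop :=
  ∀ (i : ι) (c : K), (⨆ j ∈ {j | j ≠ i}, LinearMap.range (A j)) ⊔ LinearMap.range (A i + c • 1) = ⊤

omit [Fintype ι] [DecidableEq ι] in
/-- (M2) at `c = 0` gives `Σ_j Im A_j = V` (for `p ≥ 1`), the hypothesis of Theorem 7.12.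
[cite: Haraoka2020, §7.5 condition (M2)] -/
theorem iSup_range_eq_top_of_condM2 [Nonempty ι] (A : ι → Module.End K V) (h : CondM2 A) :
    (⨆ j, LinearMap.range (A j)) = ⊤ := by
  obtain ⟨i⟩ := ‹Nonempty ι›
  have hi := h i 0
  rw [zero_smul, add_zero] at hi
  rw [eq_top_iff, ← hi]
  exact sup_le (iSup₂_le fun j _ => le_iSup (fun j => LinearMap.range (A j)) j)
    (le_iSup (fun j => LinearMap.range (A j)) i)

end Defs

end AdditiveMiddleConvolution

/-! ### The additive middle convolution `mc_μ` -/

section Main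

variable {K : Type*} [CommRing K] {V : Type*} [AddCommGroup V] [Module K V]
variable {ι : Type*} [Fintype ι] [DecidableEq ι]

open AdditiveMiddleConvolution

/-- The **additive middle convolution** `mc_μ(A) = (B₁, …, B_p)` of a tuple
`A = (A₁, …, A_p) ∈ End(V)^p` with parameter `μ` ([Haraoka2020, (7.32)]; [DettweilerReiter2007,
Def. 3.1]; [DettweilerReiter2000, Def. A.6 (a)]): `B_j` is the endomorphism of
`mc_μ(V) = V^p ⧸ (𝒦 + ℒ)` induced by `G_j` of (7.30).  Analytically, `mc_μ` is the Riemann–Liouville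
(Euler) transform `U(x) = ∫ W(s)(x - s)^μ ds` of the Fuchsian system with residues `A` followed by
the reduction to the quotient ([Haraoka2020, §7.5, (7.34)ff]); on monodromy it is Katz's `MC_λ`,
`λ = e^{2πiμ}` (tree `middleConvolution`; [DettweilerReiter2007, Thm. 4.8]).
[cite: Haraoka2020, §7.5 (7.32)] -/
def additiveMiddleConvolution (A : ι → Module.End K V) (μ : K) :
    ι → Module.End K (AdditiveMiddleConvolution.Space A μ) :=
  fun j => (kerSum A μ).mapQ (kerSum A μ) (convolutionEnd A μ j) (kerSum_le_comap A μ j)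

/-- `B_j [v] = [G_j v]`. [cite: Haraoka2020, §7.5 (7.32)] -/
@[simp]
theorem additiveMiddleConvolution_mk (A : ι → Module.End K V) (μ : K) (j : ι) (v : ι → V) :
    additiveMiddleConvolution A μ j (Submodule.Quotient.mk v) =
      Submodule.Quotient.mk (convolutionEnd A μ j v) :=
  rfl

/-- The quotient map `V^p → mc_μ(V)` intertwines `G_j` and `B_j`. [cite: Haraoka2020, §7.5 (7.32)] -/
theorem mkQ_comp_convolutionEnd (A : ι → Module.End K V) (μ : K) (j : ι) :
    (kerSum A μ).mkQ ∘ₗ convolutionEnd A μ j = additiveMiddleConvolution A μ j ∘ₗ (kerSum A μ).mkQ :=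
  rfl

/-! ### [Haraoka2020, Thm. 7.12]: `mc_0(V) ≅ V` -/

/-- For `μ = 0`, `𝒦 + ℒ = ℒ = Ker φ` with `φ(v) = Σ A_i v_i` ([Haraoka2020, proof of Thm. 7.12]).
[cite: Haraoka2020, Theorem 7.12] -/
theorem kerSum_zero_eq_ker (A : ι → Module.End K V) : kerSum A 0 = LinearMap.ker (rowMap A) := by
  rw [kerSum, sup_eq_right.2 (piKer_le_invariants_zero A)]
  ext v
  rw [mem_invariants_zero_iff, LinearMap.mem_ker]

/-- **[Haraoka2020, Thm. 7.12] (`mc_0(V) ≅ V`)**, with the hypothesis actually used in the printed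
proof, `Σ_i Im A_i = V`: the map `φ : V^p → V`, `(v_i) ↦ Σ A_i v_i`, has kernel `ℒ = 𝒦 + ℒ`, is onto,
and satisfies `φ ∘ G_i = A_i ∘ φ`; hence it induces a linear isomorphism `e : mc_0(V) ≃ V` with
`e ∘ B_i = A_i ∘ e` — an isomorphism of the `(B₁, …, B_p)`-module `mc_0(V)` with the
`(A₁, …, A_p)`-module `V`. [cite: Haraoka2020, Theorem 7.12] -/
theorem exists_linearEquiv_zero (A : ι → Module.End K V) (hA : (⨆ j, LinearMap.range (A j)) = ⊤) :
    ∃ e : AdditiveMiddleConvolution.Space A 0 ≃ₗ[K] V,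
      (∀ v : ι → V, e (Submodule.Quotient.mk v) = rowMap A v) ∧
        ∀ (i : ι) (x : AdditiveMiddleConvolution.Space A 0),
          e (additiveMiddleConvolution A 0 i x) = A i (e x) := by
  -- `φ` descends to `ψ : V^p ⧸ ℒ → V`
  let ψ : AdditiveMiddleConvolution.Space A 0 →ₗ[K] V :=
    (kerSum A 0).liftQ (rowMap A) (by rw [kerSum_zero_eq_ker])
  have hψ : ∀ v, ψ (Submodule.Quotient.mk v) = rowMap A v := fun v => rfl
  have hinj : Function.Injective ψ := by
    intro x y hxy
    obtain ⟨v, rfl⟩ := Submodule.Quotient.mk_surjective _ x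
    obtain ⟨w, rfl⟩ := Submodule.Quotient.mk_surjective _ y
    rw [hψ, hψ] at hxy
    rw [Submodule.Quotient.eq, kerSum_zero_eq_ker, LinearMap.mem_ker, map_sub, hxy, sub_self]
  have hsurj : Function.Surjective ψ := by
    rw [← LinearMap.range_eq_top, eq_top_iff, ← hA]
    refine iSup_le fun i => ?_
    rintro _ ⟨x, rfl⟩
    exact ⟨Submodule.Quotient.mk (Pi.single i x), by rw [hψ, rowMap_single]⟩
  refine ⟨LinearEquiv.ofBijective ψ ⟨hinj, hsurj⟩, fun v => hψ v, fun i x => ?_⟩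
  obtain ⟨v, rfl⟩ := Submodule.Quotient.mk_surjective _ x
  -- `φ ∘ G_i = A_i ∘ φ`
  rw [additiveMiddleConvolution_mk, LinearEquiv.ofBijective_apply, LinearEquiv.ofBijective_apply, hψ,
    hψ, convolutionEnd_apply, rowMap_single, zero_smul, add_zero, rowMap_apply, map_sum]

/-- **[Haraoka2020, Thm. 7.12] as printed**: "Assume that an `A`-module `V` satisfies the condition
(M2).  Then `mc_0(V)` is isomorphic to `V`" (as modules: the isomorphism carries `B_i` to `A_i`);
`p ≥ 1` singular points. [cite: Haraoka2020, Theorem 7.12] -/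
theorem Haraoka2020_thm_7_12 [Nonempty ι] (A : ι → Module.End K V) (hM2 : CondM2 A) :
    ∃ e : AdditiveMiddleConvolution.Space A 0 ≃ₗ[K] V,
      ∀ (i : ι) (x : AdditiveMiddleConvolution.Space A 0),
        e (additiveMiddleConvolution A 0 i x) = A i (e x) :=
  let ⟨e, _, he⟩ := exists_linearEquiv_zero A (iSup_range_eq_top_of_condM2 A hM2)
  ⟨e, he⟩

end Main

/-! ### The additive index of rigidity ([Haraoka2020, Def. 7.6]) -/

namespace AdditiveMiddleConvolution

section Index

variable {K : Type*} [Field K] {V : Type*} [AddCommGroup V] [Module K V]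
variable {ι : Type*} [Fintype ι]

/-- The residue at infinity `A₀ = -Σ_{j=1}^{p} A_j` of the Fuchsian system with finite residues
`(A₁, …, A_p)` ([Haraoka2020, (7.16)]; `-A_∞` in the notation `A_∞ = Σ A_i` of
[DettweilerReiter2000, Notation A.1]). [cite: Haraoka2020, §7.3 (7.16)] -/
def residueAtInfinity (A : ι → Module.End K V) : Module.End K V :=
  -∑ j, A j

/-- **Index of rigidity** of a tuple of residue matrices `(A₁, …, A_p)` (of the Fuchsian system of
normal form `dY/dx = Σ_{j=1}^{p} A_j/(x - a_j) Y`, with `A₀ = -Σ A_j` at `∞`):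
`ι = (1 - p) n² + Σ_{j=0}^{p} dim Z(A_j)`, `Z(A_j)` the centraliser of `A_j` in `M_n`
([Haraoka2020, Def. 7.6]; for non-resonant systems it equals the index of rigidity
`(2 - (p+1)) n² + Σ dim Z(M_j)` of the monodromy, [Haraoka2020, Def. 7.4], tree
`RigidTuple.rigidityIndex`). [cite: Haraoka2020, Definition 7.6] -/
def rigidityIndex (A : ι → Module.End K V) : ℤ :=
  (1 - (Fintype.card ι : ℤ)) * (finrank K V : ℤ) ^ 2 +
    ((∑ j, (RigidTuple.centralizerDim (A j) : ℤ)) + RigidTuple.centralizerDim (residueAtInfinity A))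

/-- A rank-one tuple has index of rigidity `(1 - p) + (p + 1) = 2` (rank-one systems are rigid).
[cite: Haraoka2020, Definition 7.6 and Theorem 7.11] -/
theorem rigidityIndex_eq_two_of_finrank_eq_one (h : finrank K V = 1) (A : ι → Module.End K V) :
    rigidityIndex A = 2 := by
  unfold rigidityIndex
  simp only [RigidTuple.centralizerDim_eq_one_of_finrank_eq_one h, h, Finset.sum_const,
    Finset.card_univ, mul_one, Nat.cast_one, one_pow]
  ring

/-- `A₀(ad_α(A)) = A₀(A) - (Σ α_j) · 1`. [cite: Haraoka2020, §7.5 (properties of ad_α, before Thm. 7.22)] -/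
theorem residueAtInfinity_addition [DecidableEq ι] (A : ι → Module.End K V) (α : ι → K) :
    residueAtInfinity (addition A α) = residueAtInfinity A - (∑ j, α j) • (1 : Module.End K V) := by
  simp only [residueAtInfinity, addition, Finset.sum_add_distrib, Finset.sum_smul, neg_add,
    sub_eq_add_neg]

/-- **`ad_α` leaves the index of rigidity invariant** ("`ad_α` leaves the spectral type of
`(A₀, A₁, …, A_p)`, and hence the index of rigidity, invariant", [Haraoka2020, §7.5, before
Thm. 7.22]): `Z(A_j + α_j) = Z(A_j)` and `Z(A₀ - Σα_j) = Z(A₀)`.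
[cite: Haraoka2020, §7.5 (properties of ad_α, before Thm. 7.22)] -/
theorem rigidityIndex_addition [DecidableEq ι] (A : ι → Module.End K V) (α : ι → K) :
    rigidityIndex (addition A α) = rigidityIndex A := by
  unfold rigidityIndex
  have h1 : ∀ j, RigidTuple.centralizerDim (addition A α j) = RigidTuple.centralizerDim (A j) := by
    intro j
    unfold RigidTuple.centralizerDim addition
    rw [← one_smul K (A j), RigidTuple.centralizer_smul_add_smul_one one_ne_zero, one_smul]
  have h2 : RigidTuple.centralizerDim (residueAtInfinity (addition A α)) =
      RigidTuple.centralizerDim (residueAtInfinity A) := by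
    unfold RigidTuple.centralizerDim
    rw [residueAtInfinity_addition, RigidTuple.centralizer_sub_smul_one]
  simp only [h1, h2]

end Index

end AdditiveMiddleConvolution

end Literature.AlgebraicGeometry.Motives

end
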